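import Summits.AtomisticToContinuum.FouriersLaw.Theorems.BondHeatUncertaintyExtensiveSnapshotIrreversibilityEnergyWindowKernelTestClassesA

/-!
# «EnergyWindowKernelTestClasses» (lens-1 g77 node Rᵇ: test-class statements (G1*ᶜᶜ)/(G1ℓ), ∂_{p_b} calculus and scaled cutoff, smooth truncation, density of the smooth core) — part 2 of 2 (sequel of `…BondHeatUncertaintyExtensiveSnapshotIrreversibilityEnergyWindowKernelTestClassesA`)

Split for the 400-line cap by the landing lane (hand-2 g30); the module docstring of part 1 (`…BondHeatUncertaintyExtensiveSnapshotIrreversibilityEnergyWindowKernelTestClassesA`) describes the whole node.  Same namespace; all FQNs unchanged.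
0 sorry; standard axioms.
-/

noncomputable section

namespace Summit.AtomisticToContinuum.FouriersLaw.Theorems.ExtensiveSnapshotIrreversibility.EnergyWindow

open MeasureTheory ProbabilityTheory Filter Topology Real Set Metric
open scoped ENNReal NNReal ContDiff
open Literature.MathematicalPhysics.KineticTheory.HeatConduction

variable {N : ℕ}

/-! ## 3. `(G1*ᶜᶜ) → (G1*)`: smooth truncation of the observable -/

/-- ★ **`(G1*ᶜᶜ) → (G1*)`.** For `C¹` `|g| ≤ Me^{θ₁H}` and the truncations `g_R = χ_R g`
(compactly supported, same envelope): `∫ χ_R ∂_b g dP = ∫ ∂_b g_R dP − ∫ g ∂_bχ_R dP`, the first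
term bounded by `(G1*ᶜᶜ)`, the second by `(K/R) M ∫ e^{θ₁H} dP^δ_s(z,·) < ∞` (CEHR (3.4), after
shrinking `δ₀` so that `θ₁ < 1/(T + δ₀/2)`); `R → ∞` by dominated convergence when
`∂_b g ∈ L¹(P^δ_s(z,·))`, and the Bochner integral is `0` otherwise.
[cite: CuneoEckmannHairerReyBellet2018, §3 eq. (3.4)] -/
theorem perturbedKernelMomentumIBP_of_compact (hI : PerturbedKernelMomentumIBPCompact) :
    PerturbedKernelMomentumIBP := by
  intro ω₂ lam β γ hω hl hβ hγ T hT N hN θ₁ θ₂ hθ₁ hθ₁₂ hθ₂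
  obtain ⟨b₀, δ₀, C, hb₀, hδ₀, hmain⟩ := hI ω₂ lam β γ hω hl hβ hγ T hT N hN θ₁ θ₂ hθ₁ hθ₁₂ hθ₂
  have hN0 : 0 < N := by omega
  have hθ₁T : θ₁ < 1 / T := hθ₁₂.trans hθ₂
  have hTθ : T < 1 / θ₁ := by
    rw [lt_div_iff₀ hθ₁]
    have := (lt_div_iff₀ hT).1 hθ₁T
    linarith [mul_comm θ₁ T]
  refine ⟨b₀, min δ₀ (min T (1 / θ₁ - T)), max C 0, hb₀, lt_min hδ₀ (lt_min hT (by linarith)),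
    fun δ hδ s hs0 hs1 b hb M hM g hgC hgM z => ?_⟩
  have hδ0 : |δ| < δ₀ := hδ.trans_le (min_le_left _ _)
  have hδT : |δ| < T := (hδ.trans_le (min_le_right _ _)).trans_le (min_le_left _ _)
  have hδθ : |δ| < 1 / θ₁ - T := (hδ.trans_le (min_le_right _ _)).trans_le (min_le_right _ _)
  have hδabs := abs_lt.1 hδT
  have hδabs' := abs_lt.1 hδθ
  have hL : 0 < T + δ / 2 := by linarith
  have hR : 0 < T - δ / 2 := by linarith
  have hmaxpos : 0 < max (T + δ / 2) (T - δ / 2) := lt_max_of_lt_left hL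
  have hmaxlt : max (T + δ / 2) (T - δ / 2) < 1 / θ₁ := max_lt (by linarith) (by linarith)
  have hθδ : θ₁ < 1 / max (T + δ / 2) (T - δ / 2) := by
    rw [lt_div_iff₀ hmaxpos]
    have := (lt_div_iff₀ hθ₁).1 hmaxlt
    linarith [mul_comm θ₁ (max (T + δ / 2) (T - δ / 2))]
  set Hm := (pinnedChain ω₂ lam β γ).hamiltonian N with hHm
  -- the kernel `P^δ_s(z,·)` as a measure
  show |∫ w, partialP b g w ∂(pinnedChain ω₂ lam β γ).transitionKernel N (T + δ / 2) (T - δ / 2)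
      s.toNNReal z| ≤ max C 0 * s ^ (-b₀) * M * Real.exp (θ₂ * Hm z)
  set μ : Measure (PhaseSpace N) :=
    (pinnedChain ω₂ lam β γ).transitionKernel N (T + δ / 2) (T - δ / 2) s.toNNReal z with hμ
  have hsb : 0 < s ^ (-b₀) := Real.rpow_pos_of_pos hs0 _
  set B : ℝ := max C 0 * s ^ (-b₀) * M * Real.exp (θ₂ * Hm z) with hB
  have hB0 : 0 ≤ B := by positivity
  by_cases hint : Integrable (partialP b g) μ
  swap
  · rw [integral_undef hint, abs_zero]
    exact hB0
  -- the weight `e^{θ₁H}` is integrable for `P^δ_s(z,·)` (CEHR (3.4))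
  set wt : PhaseSpace N → ℝ := fun y => Real.exp (θ₁ * Hm y) with hwt
  have hwm : Measurable wt :=
    (continuous_const.mul (pinnedChain_continuous_hamiltonian ω₂ lam β γ N)).rexp.measurable
  have hwle : ∀ y, |wt y| ≤ 1 * Real.exp (θ₁ * Hm y) := fun y => by
    rw [one_mul, hwt, abs_of_pos (Real.exp_pos _)]
  have hwi : Integrable wt μ :=
    (integrable_and_abs_integral_transitionKernel_le hω hl hβ hγ hN0 hL hR hθ₁ hθδ s.toNNReal z
      zero_le_one hwm hwle).1
  set I : ℝ := ∫ y, wt y ∂μ with hI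
  -- derivative data of `g` and of the profile
  have hgd : Differentiable ℝ g := hgC.differentiable one_ne_zero
  have hpgc : Continuous (partialP b g) := continuous_partialP_of_contDiff b hgC
  obtain ⟨K, hK0, hK⟩ := exists_bound_fderiv_ewBump N ((0 : Fin N → ℝ), Pi.single b 1)
  -- the truncations `g_n = χ_{n+1} g`
  have key : ∀ n : ℕ, |∫ w, ewCutoff N ((n : ℝ) + 1) w * partialP b g w ∂μ| ≤
      B + K * (1 / ((n : ℝ) + 1)) * M * I := by
    intro n
    have hRp : (0 : ℝ) < (n : ℝ) + 1 := by positivity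
    have hχC : ContDiff ℝ 1 (ewCutoff N ((n : ℝ) + 1)) := ewCutoff_contDiff _
    have hχd : Differentiable ℝ (ewCutoff N ((n : ℝ) + 1)) := hχC.differentiable one_ne_zero
    -- the truncated observable and `(G1*ᶜᶜ)` for it
    have hgnC : ContDiff ℝ 1 fun y => ewCutoff N ((n : ℝ) + 1) y * g y := hχC.mul hgC
    have hgnK : HasCompactSupport fun y => ewCutoff N ((n : ℝ) + 1) y * g y :=
      (hasCompactSupport_ewCutoff hRp).mul_right
    have hgnM : ∀ w, |ewCutoff N ((n : ℝ) + 1) w * g w| ≤ M * Real.exp (θ₁ * Hm w) := fun w => by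
      rw [abs_mul]
      exact (mul_le_of_le_one_left (abs_nonneg _) (abs_ewCutoff_le_one _ w)).trans (hgM w)
    have hS : |∫ w, partialP b (fun y => ewCutoff N ((n : ℝ) + 1) y * g y) w ∂μ| ≤ B :=
      (hmain δ hδ0 s hs0 hs1 b hb M hM _ hgnC hgnK hgnM z).trans
        (mul_le_mul_of_nonneg_right (mul_le_mul_of_nonneg_right
          (mul_le_mul_of_nonneg_right (le_max_left C 0) hsb.le) hM) (Real.exp_pos _).le)
    -- product rule and the two pieces
    have hprod : partialP b (fun y => ewCutoff N ((n : ℝ) + 1) y * g y) = fun w =>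
        ewCutoff N ((n : ℝ) + 1) w * partialP b g w +
          g w * partialP b (ewCutoff N ((n : ℝ) + 1)) w :=
      funext fun w => partialP_fun_mul b (hχd w) (hgd w)
    have hχb : ∀ w, |partialP b (ewCutoff N ((n : ℝ) + 1)) w| ≤ K / ((n : ℝ) + 1) := fun w =>
      abs_partialP_ewCutoff_le hK hRp w
    have hi1 : Integrable (fun w => ewCutoff N ((n : ℝ) + 1) w * partialP b g w) μ :=
      hint.bdd_mul hχC.continuous.aestronglyMeasurable
        (ae_of_all _ fun w => by rw [Real.norm_eq_abs]; exact abs_ewCutoff_le_one _ w)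
    have hdom : ∀ w, ‖g w * partialP b (ewCutoff N ((n : ℝ) + 1)) w‖ ≤
        K * (1 / ((n : ℝ) + 1)) * M * wt w := fun w => by
      rw [Real.norm_eq_abs, abs_mul]
      calc |g w| * |partialP b (ewCutoff N ((n : ℝ) + 1)) w|
          ≤ M * Real.exp (θ₁ * Hm w) * (K / ((n : ℝ) + 1)) :=
            mul_le_mul (hgM w) (hχb w) (abs_nonneg _) (by positivity)
        _ = K * (1 / ((n : ℝ) + 1)) * M * wt w := by rw [hwt]; ring
    have hi2 : Integrable (fun w => g w * partialP b (ewCutoff N ((n : ℝ) + 1)) w) μ :=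
      Integrable.mono' (hwi.const_mul (K * (1 / ((n : ℝ) + 1)) * M))
        (hgC.continuous.mul (continuous_partialP_of_contDiff b hχC)).aestronglyMeasurable
        (ae_of_all _ hdom)
    have hsplit : ∫ w, ewCutoff N ((n : ℝ) + 1) w * partialP b g w ∂μ =
        ∫ w, partialP b (fun y => ewCutoff N ((n : ℝ) + 1) y * g y) w ∂μ -
          ∫ w, g w * partialP b (ewCutoff N ((n : ℝ) + 1)) w ∂μ := by
      rw [hprod, integral_add hi1 hi2]
      ring
    have hI2 : |∫ w, g w * partialP b (ewCutoff N ((n : ℝ) + 1)) w ∂μ| ≤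
        K * (1 / ((n : ℝ) + 1)) * M * I := by
      rw [← Real.norm_eq_abs]
      refine (norm_integral_le_of_norm_le (hwi.const_mul _) (ae_of_all _ hdom)).trans_eq ?_
      rw [integral_const_mul]
    rw [hsplit]
    calc |∫ w, partialP b (fun y => ewCutoff N ((n : ℝ) + 1) y * g y) w ∂μ -
          ∫ w, g w * partialP b (ewCutoff N ((n : ℝ) + 1)) w ∂μ|
        ≤ |∫ w, partialP b (fun y => ewCutoff N ((n : ℝ) + 1) y * g y) w ∂μ| +
            |∫ w, g w * partialP b (ewCutoff N ((n : ℝ) + 1)) w ∂μ| := abs_sub _ _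
      _ ≤ B + K * (1 / ((n : ℝ) + 1)) * M * I := add_le_add hS hI2
  -- `R → ∞`: dominated convergence for `χ_R ∂_b g → ∂_b g`
  have hlim : Tendsto (fun n : ℕ => ∫ w, ewCutoff N ((n : ℝ) + 1) w * partialP b g w ∂μ) atTop
      (𝓝 (∫ w, partialP b g w ∂μ)) := by
    refine tendsto_integral_of_dominated_convergence (fun w => ‖partialP b g w‖)
      (fun n => ((ewCutoff_contDiff (n := 1) _).continuous.mul hpgc).aestronglyMeasurable)
      hint.norm (fun n => ae_of_all _ fun w => ?_) (ae_of_all _ fun w => ?_)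
    · rw [norm_mul, Real.norm_eq_abs (ewCutoff _ _ _)]
      exact mul_le_of_le_one_left (norm_nonneg _) (abs_ewCutoff_le_one _ w)
    · refine tendsto_const_nhds.congr' ?_
      filter_upwards [Filter.eventually_ge_atTop ⌈‖w‖⌉₊] with n hn
      rw [ewCutoff_eq_one (by positivity) ?_, one_mul]
      calc ‖w‖ ≤ (⌈‖w‖⌉₊ : ℝ) := Nat.le_ceil _
        _ ≤ (n : ℝ) := by exact_mod_cast hn
        _ ≤ (n : ℝ) + 1 := by linarith
  have hlim' : Tendsto (fun n : ℕ => B + K * (1 / ((n : ℝ) + 1)) * M * I) atTop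
      (𝓝 (B + K * 0 * M * I)) :=
    tendsto_const_nhds.add
      ((((tendsto_one_div_add_atTop_nhds_zero_nat (𝕜 := ℝ)).const_mul K).mul_const M).mul_const
        I)
  have hle := le_of_tendsto_of_tendsto' hlim.abs hlim' key
  simpa using hle

/-! ## 4. `(G1ℓ) → (G1)`: density of the smooth core and the derivative of a Lipschitz modulus -/

/-- ★ **`(G1ℓ) → (G1)`.**  The two-sided bound of `(G1ℓ)` transfers from smooth compactly
supported `|g| ≤ e^{θH}` to every measurable `|h| ≤ e^{θH}` (weighted smooth density in
`L¹(P_r(w[p_b:=t],·) + P_r(w,·))`, part P §3, the weight being integrable by CEHR (3.4));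
then at `t = p_b(w)` the slopes of `t ↦ P_r h(w[p_b := t])` are bounded by
`C r^{-a} max(e^{θ₁H(w)}, e^{θ₁H(w[p_b:=t])}) → C r^{-a} e^{θ₁H(w)}`, which bounds the derivative
when it exists; otherwise `deriv = 0`. [cite: CuneoEckmannHairerReyBellet2018, §3 eq. (3.4)] -/
theorem equalTemperatureBathGradient_of_lipschitz (hL : EqualTemperatureBathLipschitz) :
    EqualTemperatureBathGradient := by
  intro ω₂ lam β γ hω hl hβ hγ T hT N hN θ θ₁ hθ hθθ₁ hθ₁T
  obtain ⟨a, C, ha, hmain⟩ := hL ω₂ lam β γ hω hl hβ hγ T hT N hN θ θ₁ hθ hθθ₁ hθ₁T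
  have hN0 : 0 < N := by omega
  have hθT' : θ < 1 / max T T := by
    rw [max_self]
    exact hθθ₁.trans hθ₁T
  refine ⟨a, max C 0, ha, fun r hr0 hr1 h hhm hh b hb w => ?_⟩
  set Hm := (pinnedChain ω₂ lam β γ).hamiltonian N with hHm
  have hra : 0 < r ^ (-a) := Real.rpow_pos_of_pos hr0 _
  set Kc : ℝ := max C 0 * r ^ (-a) with hKc
  have hKc0 : 0 ≤ Kc := by positivity
  set φ : ℝ → ℝ := fun t =>
    max (Real.exp (θ₁ * Hm w)) (Real.exp (θ₁ * Hm (w.1, Function.update w.2 b t))) with hφ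
  have hφ0 : ∀ t, 0 ≤ φ t := fun t => le_max_of_le_left (Real.exp_pos _).le
  -- Step A: the Lipschitz bound for the measurable observable `h`
  have hLip : ∀ t : ℝ,
      |eqKernelFun ω₂ lam β γ T N h r (w.1, Function.update w.2 b t) -
          eqKernelFun ω₂ lam β γ T N h r w| ≤ Kc * |t - w.2 b| * φ t := by
    intro t
    -- the weight `e^{θH}`
    set W : PhaseSpace N → ℝ := fun y => Real.exp (θ * Hm y) with hW
    have hWC : ContDiff ℝ ∞ W :=
      (contDiff_const.mul (pinnedChain_contDiff_hamiltonian ω₂ lam β γ N)).exp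
    have hW0 : ∀ y, 0 < W y := fun y => Real.exp_pos _
    have hWm : Measurable W := hWC.continuous.measurable
    have hWle : ∀ y, |W y| ≤ 1 * Real.exp (θ * Hm y) := fun y => by
      rw [one_mul, hW, abs_of_pos (Real.exp_pos _)]
    -- the two kernels and their sum
    set ν₁ : Measure (PhaseSpace N) := (pinnedChain ω₂ lam β γ).transitionKernel N T T
      r.toNNReal (w.1, Function.update w.2 b t) with hν₁
    set ν₂ : Measure (PhaseSpace N) :=
      (pinnedChain ω₂ lam β γ).transitionKernel N T T r.toNNReal w with hν₂
    have hW1 : Integrable W ν₁ :=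
      (integrable_and_abs_integral_transitionKernel_le hω hl hβ hγ hN0 hT hT hθ hθT' r.toNNReal
        _ zero_le_one hWm hWle).1
    have hW2 : Integrable W ν₂ :=
      (integrable_and_abs_integral_transitionKernel_le hω hl hβ hγ hN0 hT hT hθ hθT' r.toNNReal
        w zero_le_one hWm hWle).1
    have hWi : Integrable W (ν₁ + ν₂) := hW1.add_measure hW2
    have hhle : ∀ y, |h y| ≤ 1 * Real.exp (θ * Hm y) := fun y => by rw [one_mul]; exact hh y
    have hh1 : Integrable h ν₁ :=
      (integrable_and_abs_integral_transitionKernel_le hω hl hβ hγ hN0 hT hT hθ hθT' r.toNNReal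
        _ zero_le_one hhm hhle).1
    have hh2 : Integrable h ν₂ :=
      (integrable_and_abs_integral_transitionKernel_le hω hl hβ hγ hN0 hT hT hθ hθT' r.toNNReal
        w zero_le_one hhm hhle).1
    refine le_of_forall_pos_le_add fun ε hε => ?_
    obtain ⟨g, hgC, hgK, hgw, hgε⟩ :=
      exists_contDiff_hasCompactSupport_integral_sub_le_of_abs_le (ν₁ + ν₂) hWC hW0 hWi hhm
        (fun y => hh y) (half_pos hε)
    have hgm : Measurable g := hgC.continuous.measurable
    have hgle : ∀ y, |g y| ≤ 1 * Real.exp (θ * Hm y) := fun y => by rw [one_mul]; exact hgw y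
    have hg1 : Integrable g ν₁ :=
      (integrable_and_abs_integral_transitionKernel_le hω hl hβ hγ hN0 hT hT hθ hθT' r.toNNReal
        _ zero_le_one hgm hgle).1
    have hg2 : Integrable g ν₂ :=
      (integrable_and_abs_integral_transitionKernel_le hω hl hβ hγ hN0 hT hT hθ hθT' r.toNNReal
        w zero_le_one hgm hgle).1
    -- `(G1ℓ)` for the smooth approximant
    have hS : |∫ y, g y ∂ν₁ - ∫ y, g y ∂ν₂| ≤ Kc * |t - w.2 b| * φ t :=
      (hmain r hr0 hr1 g hgC hgK hgw b hb w t).trans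
        (mul_le_mul_of_nonneg_right (mul_le_mul_of_nonneg_right
          (mul_le_mul_of_nonneg_right (le_max_left C 0) hra.le) (abs_nonneg _)) (hφ0 t))
    -- `∫ |h − g| dνᵢ ≤ ε/2`
    have hdi : Integrable (fun y => |h y - g y|) (ν₁ + ν₂) :=
      ((hh1.add_measure hh2).sub (hg1.add_measure hg2)).abs
    have hd1 : ∫ y, |h y - g y| ∂ν₁ ≤ ε / 2 :=
      (integral_mono_measure (Measure.le_add_right le_rfl)
        (Eventually.of_forall fun y => abs_nonneg _) hdi).trans hgε
    have hd2 : ∫ y, |h y - g y| ∂ν₂ ≤ ε / 2 :=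
      (integral_mono_measure (Measure.le_add_left le_rfl)
        (Eventually.of_forall fun y => abs_nonneg _) hdi).trans hgε
    -- assemble
    show |∫ y, h y ∂ν₁ - ∫ y, h y ∂ν₂| ≤ Kc * |t - w.2 b| * φ t + ε
    have e1 : ∫ y, h y ∂ν₁ = ∫ y, g y ∂ν₁ + ∫ y, (h y - g y) ∂ν₁ := by
      rw [integral_sub hh1 hg1]; ring
    have e2 : ∫ y, h y ∂ν₂ = ∫ y, g y ∂ν₂ + ∫ y, (h y - g y) ∂ν₂ := by
      rw [integral_sub hh2 hg2]; ring
    rw [e1, e2]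
    calc |∫ y, g y ∂ν₁ + ∫ y, (h y - g y) ∂ν₁ - (∫ y, g y ∂ν₂ + ∫ y, (h y - g y) ∂ν₂)|
        = |(∫ y, g y ∂ν₁ - ∫ y, g y ∂ν₂) +
            (∫ y, (h y - g y) ∂ν₁ - ∫ y, (h y - g y) ∂ν₂)| := by ring_nf
      _ ≤ |∫ y, g y ∂ν₁ - ∫ y, g y ∂ν₂| +
            |∫ y, (h y - g y) ∂ν₁ - ∫ y, (h y - g y) ∂ν₂| := abs_add_le _ _
      _ ≤ Kc * |t - w.2 b| * φ t + (|∫ y, (h y - g y) ∂ν₁| + |∫ y, (h y - g y) ∂ν₂|) :=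
          add_le_add hS (abs_sub _ _)
      _ ≤ Kc * |t - w.2 b| * φ t + (∫ y, |h y - g y| ∂ν₁ + ∫ y, |h y - g y| ∂ν₂) := by
          gcongr <;> exact abs_integral_le_integral_abs
      _ ≤ Kc * |t - w.2 b| * φ t + (ε / 2 + ε / 2) := by gcongr
      _ = Kc * |t - w.2 b| * φ t + ε := by rw [add_halves]
  -- Step B: the derivative at `t = p_b(w)` is bounded by the local Lipschitz constant
  show |deriv (fun t => eqKernelFun ω₂ lam β γ T N h r (w.1, Function.update w.2 b t)) (w.2 b)|
      ≤ max C 0 * r ^ (-a) * Real.exp (θ₁ * Hm w)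
  set F : ℝ → ℝ := fun t => eqKernelFun ω₂ lam β γ T N h r (w.1, Function.update w.2 b t)
    with hF
  have hF0 : F (w.2 b) = eqKernelFun ω₂ lam β γ T N h r w := by
    simp only [hF, updatePath_self]
  have hLipF : ∀ t : ℝ, |F t - F (w.2 b)| ≤ Kc * |t - w.2 b| * φ t := fun t => by
    rw [hF0]; exact hLip t
  have hφc : Continuous φ :=
    continuous_const.max (continuous_const.mul
      ((pinnedChain_continuous_hamiltonian ω₂ lam β γ N).comp (continuous_updatePath b w))).rexp
  have hφw : φ (w.2 b) = Real.exp (θ₁ * Hm w) := by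
    simp only [hφ, updatePath_self, max_self]
  by_cases hd : DifferentiableAt ℝ F (w.2 b)
  · have hder : Tendsto (slope F (w.2 b)) (𝓝[≠] (w.2 b)) (𝓝 (deriv F (w.2 b))) :=
      hasDerivAt_iff_tendsto_slope.1 hd.hasDerivAt
    have hφt : Tendsto (fun t => Kc * φ t) (𝓝[≠] (w.2 b)) (𝓝 (Kc * φ (w.2 b))) :=
      ((hφc.tendsto (w.2 b)).mono_left nhdsWithin_le_nhds).const_mul Kc
    have hev : (fun t => |slope F (w.2 b) t|) ≤ᶠ[𝓝[≠] (w.2 b)] fun t => Kc * φ t := by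
      filter_upwards [self_mem_nhdsWithin] with t ht
      have hne : 0 < |t - w.2 b| := abs_pos.2 (sub_ne_zero.2 ht)
      rw [slope_def_field, abs_div, div_le_iff₀ hne, mul_right_comm]
      exact hLipF t
    have hle := le_of_tendsto_of_tendsto hder.abs hφt hev
    rw [hφw] at hle
    exact hle
  · rw [deriv_zero_of_not_differentiableAt hd, abs_zero]
    positivity

/-! ## 5. Junctions through the test classes -/

/-- ★ **`(Dˢ) → (G1ℓ) → (G1*ᶜᶜ) → S3`.** [folklore] -/
theorem kernelTemperatureLipschitz_of_testClasses (hD : KernelTemperatureDuhamelSmooth)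
    (hG : EqualTemperatureBathLipschitz) (hI : PerturbedKernelMomentumIBPCompact) :
    KernelTemperatureLipschitz :=
  kernelTemperatureLipschitz_of_smoothDuhamel hD (equalTemperatureBathGradient_of_lipschitz hG)
    (perturbedKernelMomentumIBP_of_compact hI)

/-- **Glue `A0 → A2 → (Dˢ) → (G1ℓ) → (G1*ᶜᶜ) → A3p → A4 → (W)`.** [folklore] -/
theorem energyWindowControl_of_atoms₇R (h0 : NessGibbsReweighting) (h2 : NessOddLogRatioBound)
    (hD : KernelTemperatureDuhamelSmooth) (hG : EqualTemperatureBathLipschitz)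
    (hI : PerturbedKernelMomentumIBPCompact) (h3p : NessFloorMeanValue)
    (h4 : NessLinearResponseL2) : EnergyWindowControl :=
  energyWindowControl_of_atoms₅K h0 h2 (kernelTemperatureLipschitz_of_testClasses hD hG hI) h3p h4

/-- ★ **The junction `K_fix ⟸ A0 ∧ A2 ∧ (Dˢ) ∧ (G1ℓ) ∧ (G1*ᶜᶜ) ∧ A3p ∧ A4`.** [folklore] -/
theorem snapshotKLUpperExpansion_of_atoms₇R (h0 : NessGibbsReweighting)
    (h2 : NessOddLogRatioBound) (hD : KernelTemperatureDuhamelSmooth)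
    (hG : EqualTemperatureBathLipschitz) (hI : PerturbedKernelMomentumIBPCompact)
    (h3p : NessFloorMeanValue) (h4 : NessLinearResponseL2) : SnapshotKLUpperExpansion :=
  snapshotKLUpperExpansion_of_atoms₅K h0 h2 (kernelTemperatureLipschitz_of_testClasses hD hG hI)
    h3p h4

end Summit.AtomisticToContinuum.FouriersLaw.Theorems.ExtensiveSnapshotIrreversibility.EnergyWindow

end
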